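import Literature.NumberTheory.EllipticCurves.ComplexMultiplicationDeuringRamified1728Proofs
import Literature.RingTheory.DiscreteValuationRing.AdicCompletionResidueField
import HarnessLib

/-!
# Deuring at the ramified prime for `j = 1728`: the `K`-side (`y² = x³ + mx` over `ℚ₂(i)`)

Sibling proof file of `Literature.NumberTheory.EllipticCurves.ComplexMultiplicationDeuringRamified1728Proofs`
(D-0014 append protocol; everything here is proved, no definitions). That file reduced the
ramified statement of Deuring's theorem at `j = 1728` to the single hypothesis `hβ`: for odd
`m`, the CM field `K ≅ ℚ(i)` of `j = 1728` and its place `w` above `2` (ramification index `2`),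
the local Euler factor of `(y² = x³ + mx)_K` at `w` is `1`. This file **proves `hβ`**
(`localEulerFactor_baseChange_mk_odd_eq_one`): the equation `y² = x³ + mx` (`Δ = -2⁶m³`,
`c₄ = -2⁴·3m`, so `ord_w Δ = 12`, `ord_w c₄ = 8` for the normalised valuation of
`K_w ≅ ℚ₂(i)`, `ord_w 2 = 2`) is a **minimal** Weierstrass equation over `𝓞_w ≅ ℤ₂[i]`
(`isMinimal_baseChange_mk_odd`), hence has additive reduction at `w`
(`hasAdditiveReductionAt_of_isMinimalAt`) and local factor `1`
(`localEulerFactor_eq_one_of_hasAdditiveReductionAt`).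

The minimality is the direct argument of Silverman, *AEC* VII.1 (as on the `ℚ`-side,
`isMinimalAt_two_mk_four_mul_odd`, and in the tree's `CongruentNumberCurveMinimalAtTwo`), now in
the wildly ramified quadratic field `K_w`: if `[u, r, s, t] • E` were `𝓞_w`-integral with
`|u|_w < 1`, integrality of `Δ' = u⁻¹²Δ` forces `ord_w u = 1`, and integrality of
`a₂' = (3r - s²)/u²`, `a₃' = 2t/u³`, `a₄' = (m + 3r² - 2st)/u⁴`, `a₆' = (rm + r³ - t²)/u⁶` gives
`ord(3r - s²) ≥ 2`, `ord t ≥ 1`, `ord(m + 3r² - 2st) ≥ 4`, `ord(rm + r³ - t²) ≥ 6`. Then `r` is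
integral (else `ord(rm + r³ - t²) = 3 ord r < 0`), `s` is integral (`s² = 3r - (3r - s²)`), `r`
and `s` are units (from `a₄'`, `a₂'` and `ord m = 0`); as **the residue field of `w` is `𝔽₂`**
(`f(w|2) = 1` since `e(w|2) = 2` in the quadratic field `K`,
`natCard_residueField_eq_natGenerator_of_ramificationIdx_eq_two`), `s ≡ 1 (mod π)`, so
`s² ≡ 1 (mod π²)`, `3r ≡ 1 (mod π²)`, `r ≡ 1 (mod π²)`, `r² ≡ 1 (mod π⁴)`; writing
`m + 3r² - 2st = (m + 3) + 3(r² - 1) - 2st`: for `m ≡ 3 (mod 4)`, `ord(m + 3) = 2` while the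
other two terms have order `≥ 3`, contradicting `ord ≥ 4`; for `m ≡ 1 (mod 4)`, `ord(m+3) ≥ 4`
forces `ord(2st) ≥ 4`, `ord t ≥ 2`, and then in `rm + r³ - t² = r((m + 1) + (r² - 1)) - t²` the
first term has order exactly `ord(m + 1) = 2` and `ord t² ≥ 4`, contradicting `ord ≥ 6`.

Consequences: the ramified statement `hR` of
`Deuring_localEulerFactor_baseChange_cmField_of_inert_of_ramified` is now proved for **all**
`j ∈ maximalCMJInvariants` (`Deuring_localEulerFactor_ramified`), and Deuring's
`L(E_K/K, s) = L(E/ℚ, s)²` is reduced to the inert statement `hI` alone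
(`Deuring_localEulerFactor_baseChange_cmField_of_inert`,
`Deuring_LFunction_baseChange_cmField_of_inert`).

## References

* J. H. Silverman, *Advanced Topics in the Arithmetic of Elliptic Curves*, GTM 151 (1994),
  Ch. II Thm. 10.5 and its proof (PDF pp. 171–172), Exercises 2.31(a), 2.32 (PDF p. 179),
  Thm. 9.2(b). [SilvermanATAEC1994]
* J. H. Silverman, *The Arithmetic of Elliptic Curves*, 2nd ed. (2009), VII.1 (Remark 1.1,
  Prop. 1.3(d)), VII.5 Prop. 5.1(c). [SilvermanAEC2009]
-/

noncomputable section

open scoped Classical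

open IsDedekindDomain NumberField Rat.HeightOneSpectrum WeierstrassCurve

namespace Literature.NumberTheory.EllipticCurves

/-! ### Discreteness of `ℤᵐ⁰`, continued -/

/-- In `ℤᵐ⁰`, `x² ≤ 1` implies `x ≤ 1`. [folklore] -/
theorem withZero_le_one_of_sq_le_one {x : WithZero (Multiplicative ℤ)} (h : x ^ 2 ≤ 1) : x ≤ 1 := by
  induction x using WithZero.expRecOn with
  | zero => exact zero_le
  | exp a =>
    rw [← WithZero.exp_nsmul, ← WithZero.exp_zero, WithZero.exp_le_exp] at h
    rw [← WithZero.exp_zero, WithZero.exp_le_exp]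
    simp only [nsmul_eq_mul, Nat.cast_ofNat] at h
    omega

/-- In `ℤᵐ⁰`, `1 < x` implies `x = exp a` for some integer `a ≥ 1`. [folklore] -/
theorem withZero_exists_eq_exp_of_one_lt {x : WithZero (Multiplicative ℤ)} (h : 1 < x) :
    ∃ a : ℤ, 1 ≤ a ∧ x = WithZero.exp a := by
  induction x using WithZero.expRecOn with
  | zero => exact absurd h (not_lt.mpr zero_le)
  | exp a =>
    rw [← WithZero.exp_zero, WithZero.exp_lt_exp] at h
    exact ⟨a, h, rfl⟩

/-! ### The residue field at a ramified place of a quadratic field is `𝔽_p` -/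

section ResidueField

variable (K : Type*) [Field K] [NumberField K] (w : HeightOneSpectrum (𝓞 K))

/-- `#(𝓞 ℚ ⧸ v) = p_v` (via `𝓞 ℚ ⧸ v ≃ ℤ ⧸ (p) ≃ ZMod p`; cf. the `absNorm` form
`absNorm_asIdeal_eq_natGenerator` in `DiophantineGeometry/MinimalDiscriminantRingOfIntegersProofs`).
[folklore] -/
theorem natCard_quot_asIdeal_eq_natGenerator (v : HeightOneSpectrum (𝓞 ℚ)) :
    Nat.card (𝓞 ℚ ⧸ v.asIdeal) = natGenerator v := by
  have e : 𝓞 ℚ ⧸ v.asIdeal ≃+* ℤ ⧸ Ideal.span {(natGenerator v : ℤ)} :=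
    Ideal.quotientEquiv _ _ (Rat.IsIntegralClosure.intEquiv (𝓞 ℚ)) (span_natGenerator v)
  rw [Nat.card_congr (e.trans (Int.quotientSpanNatEquivZMod _)).toEquiv, Nat.card_zmod]

/-- In a quadratic number field a place of ramification index `2` has inertia degree `1`
(`e · f · g = 2`, `placesOver_trichotomy_of_finrank_eq_two`). [folklore] -/
theorem inertiaDeg_eq_one_of_ramificationIdx_eq_two (h2 : Module.finrank ℚ K = 2)
    (he : w.asIdeal.ramificationIdx (𝓞 ℚ) = 2) : w.asIdeal.inertiaDeg (𝓞 ℚ) = 1 := by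
  rcases placesOver_trichotomy_of_finrank_eq_two K h2 (w.under (𝓞 ℚ)) with
    ⟨w₁, w₂, -, -, hall⟩ | ⟨w₀, hS, he1, -⟩ | ⟨w₀, hS, -, hf1⟩
  · have h1 := (hall w rfl).1
    omega
  · have hw : w ∈ ({w' : HeightOneSpectrum (𝓞 K) | w'.under (𝓞 ℚ) = w.under (𝓞 ℚ)}) := rfl
    rw [hS, Set.mem_singleton_iff] at hw
    subst hw
    omega
  · have hw : w ∈ ({w' : HeightOneSpectrum (𝓞 K) | w'.under (𝓞 ℚ) = w.under (𝓞 ℚ)}) := rfl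
    rw [hS, Set.mem_singleton_iff] at hw
    subst hw
    exact hf1

/-- **The residue field of `𝓞_w` at a ramified place of a quadratic field has `p` elements**:
`#κ(𝓞_w) = #(𝓞 K ⧸ w) = #(𝓞 ℚ ⧸ v)^{f(w|v)} = p` (Mathlib `Ideal.cardQuot_pow_inertiaDeg`,
the tree's `natCard_residueField_adicCompletionIntegers`). [folklore] -/
theorem natCard_residueField_eq_natGenerator_of_ramificationIdx_eq_two
    (h2 : Module.finrank ℚ K = 2) (he : w.asIdeal.ramificationIdx (𝓞 ℚ) = 2) :
    Nat.card (IsLocalRing.ResidueField (w.adicCompletionIntegers K)) =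
      natGenerator (w.under (𝓞 ℚ)) := by
  rw [HeightOneSpectrum.natCard_residueField_adicCompletionIntegers K w]
  set v := w.under (𝓞 ℚ) with hv
  haveI : w.asIdeal.LiesOver v.asIdeal := ⟨rfl⟩
  haveI : v.asIdeal.IsMaximal := v.isMaximal
  haveI : w.asIdeal.IsMaximal := w.isMaximal
  have h := Ideal.cardQuot_pow_inertiaDeg v.asIdeal w.asIdeal
  rw [inertiaDeg_eq_one_of_ramificationIdx_eq_two K w h2 he, pow_one, Submodule.cardQuot_apply,
    Submodule.cardQuot_apply, natCard_quot_asIdeal_eq_natGenerator] at h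
  exact h.symm

/-- **Units of `𝓞_w` are `≡ 1 (mod 𝔪_w)` when the residue field is `𝔽₂`**: if `#κ(𝓞_w) = 2`
and `|a|_w = 1` then `|a - 1|_w ≤ exp(-1)`. [folklore] -/
theorem valued_sub_one_le_of_natCard_residueField_eq_two
    (h2 : Nat.card (IsLocalRing.ResidueField (w.adicCompletionIntegers K)) = 2)
    {a : w.adicCompletion K} (ha : Valued.v a = 1) :
    Valued.v (a - 1) ≤ WithZero.exp (-1 : ℤ) := by
  set O := w.adicCompletionIntegers K with hO
  set o : O := ⟨a, (HeightOneSpectrum.mem_adicCompletionIntegers _ K w).mpr ha.le⟩ with ho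
  have ho1 : IsLocalRing.residue O o = 1 := by
    have hunit : IsUnit o :=
      HeightOneSpectrum.adicCompletionIntegers.isUnit_iff_valued_eq_one.mpr ha
    have hne : IsLocalRing.residue O o ≠ 0 := (IsLocalRing.residue_ne_zero_iff_isUnit o).mpr hunit
    obtain ⟨y, -, huniq⟩ := (Nat.card_eq_two_iff' (0 : IsLocalRing.ResidueField O)).mp h2
    exact (huniq _ hne).trans (huniq 1 one_ne_zero).symm
  have hmem : o - 1 ∈ IsLocalRing.maximalIdeal O := by
    rw [← IsLocalRing.residue_eq_zero_iff, map_sub, map_one, ho1, sub_self]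
  have hnu : ¬ IsUnit (o - 1) := (IsLocalRing.mem_maximalIdeal _).mp hmem
  rw [HeightOneSpectrum.adicCompletionIntegers.isUnit_iff_valued_eq_one] at hnu
  have hle : Valued.v ((o - 1 : O) : w.adicCompletion K) ≤ 1 :=
    (HeightOneSpectrum.mem_adicCompletionIntegers _ K w).mp (o - 1).2
  have hlt : Valued.v (a - 1) < 1 := by
    have := lt_of_le_of_ne hle hnu
    simpa [ho] using this
  have := withZero_le_exp_sub_one_of_lt_exp (k := 0) (by rwa [WithZero.exp_zero])
  simpa using this

end ResidueField

/-! ### Minimality of `y² = x³ + mx` over `𝓞_w`, `w ∣ 2` ramified in `K ≅ ℚ(i)` -/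

section KSideOdd

variable (K : Type) [Field K] [NumberField K] (w : HeightOneSpectrum (𝓞 K))

/-- **`y² = x³ + mx`, `m` odd, is a minimal Weierstrass equation over `𝓞_w`** for the place
`w` above `2` (ramification index `2`) of the CM field `K ≅ ℚ(i)` of `j = 1728` (Silverman,
*AEC* VII.1; `ord_w Δ = 12`, and the congruence argument of the module docstring excludes an
integral model with `ord_w u = 1`). [cite: SilvermanAEC2009, VII.1 (Remark 1.1, Prop. 1.3(d))] -/
theorem isMinimal_baseChange_mk_odd (hK : IsCMFieldOfJ K 1728) {m : ℤ} (hm : Odd m)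
    (he : w.asIdeal.ramificationIdx (𝓞 ℚ) = 2) :
    ((((⟨0, 0, 0, (m : ℚ), 0⟩ : WeierstrassCurve ℚ).baseChange K).baseChange
      (w.adicCompletion K)).IsMinimal (w.adicCompletionIntegers K)) := by
  set v := w.under (𝓞 ℚ) with hv_def
  -- `p = 2`
  have hpd := natGenerator_dvd_cmFieldDiscr_of_ramificationIdx_eq_two
    (show (1728 : ℚ) ∈ maximalCMJInvariants by simp [maximalCMJInvariants]) K hK w he
  norm_num [cmFieldDiscr] at hpd
  have hv : natGenerator v = 2 := by
    have h4 : (natGenerator v : ℤ) ∣ 2 ^ 2 := by norm_num; exact hpd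
    exact Rat.natGenerator_eq_of_dvd v Nat.prime_two
      (by exact_mod_cast (Rat.prime_natGenerator_int v).dvd_of_dvd_pow h4)
  -- the residue field of `w` is `𝔽₂`
  have hres : ∀ a : w.adicCompletion K, Valued.v a = 1 →
      Valued.v (a - 1) ≤ WithZero.exp (-1 : ℤ) := fun a ha ↦
    valued_sub_one_le_of_natCard_residueField_eq_two K w
      (by rw [natCard_residueField_eq_natGenerator_of_ramificationIdx_eq_two K w hK.1 he, ← hv_def, hv])
      ha
  -- valuations of rational numbers and integers in `K_w`
  have hval : ∀ x : ℚ, Valued.v (algebraMap K (w.adicCompletion K) (algebraMap ℚ K x)) =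
      v.valuation ℚ x ^ 2 := by
    intro x
    rw [WeierstrassCurve.valued_algebraMap_adicCompletion]
    exact valuation_algebraMap_of_ramificationIdx_eq_two K w he x
  have hvalZ : ∀ z : ℤ, Valued.v (z : w.adicCompletion K) = v.valuation ℚ (z : ℚ) ^ 2 := by
    intro z
    rw [← map_intCast (algebraMap K (w.adicCompletion K)) z, ← map_intCast (algebraMap ℚ K) z,
      hval]
  have hZ1 : ∀ z : ℤ, ¬ (2 : ℤ) ∣ z → Valued.v (z : w.adicCompletion K) = 1 := by
    intro z hz
    rw [hvalZ, GaloisRepresentations.Rat.valuation_intCast_eq_one v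
      (by rw [hv]; exact_mod_cast hz), one_pow]
  have hZle : ∀ (z : ℤ) (k : ℕ), (2 : ℤ) ^ k ∣ z →
      Valued.v (z : w.adicCompletion K) ≤ WithZero.exp (-(k : ℤ)) ^ 2 := by
    intro z k hz
    rw [hvalZ]
    exact pow_le_pow_left' (GaloisRepresentations.Rat.valuation_intCast_le v (n := z) (e := k)
      (by rw [hv]; exact_mod_cast hz)) 2
  have V2 : Valued.v (2 : w.adicCompletion K) = WithZero.exp (-2 : ℤ) := by
    have h := hvalZ 2
    have h2 := GaloisRepresentations.Rat.valuation_natGenerator v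
    rw [hv, Nat.cast_ofNat] at h2
    simp only [Int.cast_ofNat] at h
    rw [h, h2, ← WithZero.exp_nsmul]
    norm_num
  have V3 : Valued.v (3 : w.adicCompletion K) = 1 := by
    have h := hZ1 3 (by omega)
    rwa [Int.cast_ofNat] at h
  have Vm : Valued.v (m : w.adicCompletion K) = 1 :=
    hZ1 m (fun h ↦ Int.not_even_iff_odd.mpr hm (even_iff_two_dvd.mpr h))
  -- `|2^k q| = exp(-2k)` for odd `q`
  have hZpow : ∀ (q : ℤ) (k : ℕ), ¬ (2 : ℤ) ∣ q →
      Valued.v ((2 : w.adicCompletion K) ^ k * (q : w.adicCompletion K)) =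
        WithZero.exp (-2 : ℤ) ^ k := by
    intro q k hq
    rw [Valuation.map_mul, Valuation.map_pow, V2, hZ1 q hq, mul_one]
  -- some constants in `ℤᵐ⁰`
  have hlt10 : WithZero.exp (-1 : ℤ) < 1 := by
    rw [← WithZero.exp_zero, WithZero.exp_lt_exp]; norm_num
  have hlt20 : WithZero.exp (-2 : ℤ) < 1 := by
    rw [← WithZero.exp_zero, WithZero.exp_lt_exp]; norm_num
  -- the curve
  set E : WeierstrassCurve ℚ := ⟨0, 0, 0, (m : ℚ), 0⟩ with hE
  set X : WeierstrassCurve (w.adicCompletion K) :=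
    (E.baseChange K).baseChange (w.adicCompletion K) with hX
  have hXa₁ : X.a₁ = 0 := by simp [hX, hE, baseChange]
  have hXa₂ : X.a₂ = 0 := by simp [hX, hE, baseChange]
  have hXa₃ : X.a₃ = 0 := by simp [hX, hE, baseChange]
  have hXa₆ : X.a₆ = 0 := by simp [hX, hE, baseChange]
  have hXa₄ : X.a₄ = (m : w.adicCompletion K) := by
    simp only [hX, hE, baseChange, map_a₄, map_intCast]
  have h2m3 : ¬ ((natGenerator v : ℕ) : ℤ) ∣ -(m ^ 3) := by
    rw [hv, Int.dvd_neg]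
    intro h
    exact Int.not_even_iff_odd.mpr hm
      (even_iff_two_dvd.mpr (Int.prime_two.dvd_of_dvd_pow (by exact_mod_cast h)))
  have hEΔ : E.Δ = (natGenerator v : ℚ) ^ 6 * ((-(m ^ 3) : ℤ) : ℚ) := by
    rw [hv]
    simp only [hE, WeierstrassCurve.Δ, WeierstrassCurve.b₂, WeierstrassCurve.b₄,
      WeierstrassCurve.b₆, WeierstrassCurve.b₈]
    push_cast
    ring
  have hXΔ : Valued.v X.Δ = WithZero.exp (-12 : ℤ) := by
    rw [hX, baseChange, baseChange, map_Δ, map_Δ, hval, hEΔ,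
      WeierstrassCurve.Rat.valuation_pow_mul_intCast v h2m3 6, ← WithZero.exp_nsmul]
    norm_num
  have hV1 : ∀ x : w.adicCompletion K,
      x ∈ (algebraMap (w.adicCompletionIntegers K) (w.adicCompletion K)).range →
        Valued.v x ≤ 1 :=
    fun x hx ↦ (valued_le_one_iff_mem_range_adicCompletionIntegers w x).mpr hx
  rw [isMinimal_iff_of_le_one_iff (valued_le_one_iff_mem_range_adicCompletionIntegers w)]
  refine ⟨?_, fun C hC ↦ ?_⟩
  · refine (E.baseChange K).isIntegralAt_of_valuation_le_one w ?_ ?_ ?_ ?_ ?_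
    · simp only [hE, baseChange, map_a₁, map_zero]; exact zero_le
    · simp only [hE, baseChange, map_a₂, map_zero]; exact zero_le
    · simp only [hE, baseChange, map_a₃, map_zero]; exact zero_le
    · rw [baseChange, map_a₄, hE, valuation_algebraMap_of_ramificationIdx_eq_two K w he]
      exact pow_le_one' (Rat.valuation_intCast_le_one v m) 2
    · simp only [hE, baseChange, map_a₆, map_zero]; exact zero_le
  -- integrality of the transformed coefficients and discriminant
  obtain ⟨-, h2, h3, h4, h6⟩ := (isIntegral_iff_forall_mem_range (C • X)).mp hC
  replace h2 := hV1 _ h2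
  replace h3 := hV1 _ h3
  replace h4 := hV1 _ h4
  replace h6 := hV1 _ h6
  have e2 : (C • X).a₂ = ↑C.u⁻¹ ^ 2 * (3 * C.r - C.s ^ 2) := by
    rw [variableChange_a₂, hXa₁, hXa₂]; ring
  have e3 : (C • X).a₃ = ↑C.u⁻¹ ^ 3 * (2 * C.t) := by rw [variableChange_a₃, hXa₁, hXa₃]; ring
  have e4 : (C • X).a₄ = ↑C.u⁻¹ ^ 4 *
      ((m : w.adicCompletion K) + 3 * C.r ^ 2 - 2 * C.s * C.t) := by
    rw [variableChange_a₄, hXa₁, hXa₂, hXa₃, hXa₄]; ring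
  have e6 : (C • X).a₆ = ↑C.u⁻¹ ^ 6 *
      (C.r * (m : w.adicCompletion K) + C.r ^ 3 - C.t ^ 2) := by
    rw [variableChange_a₆, hXa₁, hXa₂, hXa₃, hXa₄, hXa₆]; ring
  rw [e2, Valuation.map_mul, Valuation.map_pow] at h2
  rw [e3, Valuation.map_mul, Valuation.map_pow] at h3
  rw [e4, Valuation.map_mul, Valuation.map_pow] at h4
  rw [e6, Valuation.map_mul, Valuation.map_pow] at h6
  have hΔ' : Valued.v (C • X).Δ ≤ 1 := by
    obtain ⟨d, hd⟩ := Δ_integral_of_isIntegral (w.adicCompletionIntegers K) (C • X)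
    rw [← hd]
    exact hV1 _ ⟨d, rfl⟩
  rw [variableChange_Δ, Valuation.map_mul, Valuation.map_pow, hXΔ] at hΔ'
  rw [variableChange_Δ, Valuation.map_mul, Valuation.map_pow, hXΔ]
  set U : WithZero (Multiplicative ℤ) := Valued.v (↑C.u⁻¹ : w.adicCompletion K) with hU
  by_cases hU1 : U ≤ 1
  · calc U ^ 12 * WithZero.exp (-12 : ℤ) ≤ 1 * WithZero.exp (-12 : ℤ) :=
          mul_le_mul' (pow_le_one' hU1 _) le_rfl
      _ = WithZero.exp (-12 : ℤ) := one_mul _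
  exfalso
  replace hU1 : 1 < U := not_le.mp hU1
  have hU0 : U ≠ 0 := (Valuation.ne_zero_iff _).mpr (Units.ne_zero _)
  -- `ord(u) = 1`
  have hUe : U = WithZero.exp (1 : ℤ) := by
    have hl1 : 0 < WithZero.log U := WithZero.lt_log_of_exp_lt (by rwa [WithZero.exp_zero])
    have hl2 : 12 * WithZero.log U + (-12) ≤ 0 := by
      have hne : U ^ 12 * WithZero.exp (-12 : ℤ) ≠ 0 :=
        mul_ne_zero (pow_ne_zero _ hU0) WithZero.exp_ne_zero
      have := (WithZero.log_le_log hne one_ne_zero).mpr hΔ'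
      rw [WithZero.log_mul (pow_ne_zero _ hU0) WithZero.exp_ne_zero, WithZero.log_pow,
        WithZero.log_exp, WithZero.log_one] at this
      simpa [nsmul_eq_mul] using this
    have hlog : WithZero.log U = 1 := by omega
    rw [← WithZero.exp_log hU0, hlog]
  have hUe2 : U ^ 2 = WithZero.exp (2 : ℤ) := by rw [hUe, ← WithZero.exp_nsmul]; norm_num
  have hUe3 : U ^ 3 = WithZero.exp (3 : ℤ) := by rw [hUe, ← WithZero.exp_nsmul]; norm_num
  have hUe4 : U ^ 4 = WithZero.exp (4 : ℤ) := by rw [hUe, ← WithZero.exp_nsmul]; norm_num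
  have hUe6 : U ^ 6 = WithZero.exp (6 : ℤ) := by rw [hUe, ← WithZero.exp_nsmul]; norm_num
  rw [hUe2] at h2
  rw [hUe3] at h3
  rw [hUe4] at h4
  rw [hUe6] at h6
  -- `|3r - s²| ≤ exp(-2)`, `|t| ≤ exp(-1)`, `|m + 3r² - 2st| ≤ exp(-4)`, `|rm + r³ - t²| ≤ exp(-6)`
  have hrs : Valued.v (3 * C.r - C.s ^ 2) ≤ WithZero.exp (-2 : ℤ) :=
    withZero_le_exp_neg_of_exp_mul_le h2
  have ht : Valued.v C.t ≤ WithZero.exp (-1 : ℤ) := by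
    have h := withZero_le_exp_neg_of_exp_mul_le h3
    rw [Valuation.map_mul, V2] at h
    refine withZero_le_of_exp_mul_le_exp_mul (k := -2) ?_
    rw [withZero_exp_mul_exp]
    norm_num
    exact h
  have hE4 : Valued.v ((m : w.adicCompletion K) + 3 * C.r ^ 2 - 2 * C.s * C.t) ≤
      WithZero.exp (-4 : ℤ) :=
    withZero_le_exp_neg_of_exp_mul_le h4
  have hE6 : Valued.v (C.r * (m : w.adicCompletion K) + C.r ^ 3 - C.t ^ 2) ≤
      WithZero.exp (-6 : ℤ) :=
    withZero_le_exp_neg_of_exp_mul_le h6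
  have ht2 : Valued.v (C.t ^ 2) ≤ WithZero.exp (-2 : ℤ) := by
    rw [Valuation.map_pow]
    calc Valued.v C.t ^ 2 ≤ WithZero.exp (-1 : ℤ) ^ 2 := pow_le_pow_left' ht 2
      _ = WithZero.exp (-2 : ℤ) := by rw [← WithZero.exp_nsmul]; norm_num
  -- Step 1: `r` is integral (else `|rm + r³ - t²| = |r|³ > 1`)
  have hr : Valued.v C.r ≤ 1 := by
    by_contra hlt
    obtain ⟨a, ha1, ha⟩ := withZero_exists_eq_exp_of_one_lt (not_le.mp hlt)
    have h3a : Valued.v (C.r ^ 3) = WithZero.exp (3 * a) := by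
      rw [Valuation.map_pow, ha, ← WithZero.exp_nsmul]
      simp
    have hlow : Valued.v (C.r * (m : w.adicCompletion K) - C.t ^ 2) < Valued.v (C.r ^ 3) := by
      refine lt_of_le_of_lt (Valuation.map_sub _ _ _) (max_lt ?_ ?_)
      · rw [Valuation.map_mul, Vm, mul_one, h3a, ha, WithZero.exp_lt_exp]
        omega
      · refine lt_of_le_of_lt ht2 ?_
        rw [h3a, WithZero.exp_lt_exp]
        omega
    have heq : Valued.v (C.r * (m : w.adicCompletion K) + C.r ^ 3 - C.t ^ 2) =
        Valued.v (C.r ^ 3) := by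
      rw [show C.r * (m : w.adicCompletion K) + C.r ^ 3 - C.t ^ 2 =
        C.r ^ 3 + (C.r * (m : w.adicCompletion K) - C.t ^ 2) by ring,
        Valuation.map_add_eq_of_lt_left _ hlow]
    rw [heq, h3a, WithZero.exp_le_exp] at hE6
    omega
  -- Step 2: `s` is integral (`s² = 3r - (3r - s²)`)
  have hs : Valued.v C.s ≤ 1 := by
    refine withZero_le_one_of_sq_le_one ?_
    rw [← Valuation.map_pow, show C.s ^ 2 = 3 * C.r - (3 * C.r - C.s ^ 2) by ring]
    refine Valuation.map_sub_le _ ?_ (hrs.trans hlt20.le)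
    rw [Valuation.map_mul, V3, one_mul]
    exact hr
  -- Step 3: `r` is a unit (`m = (m + 3r² - 2st) - 3r² + 2st` and `|m| = 1`)
  have hr1 : Valued.v C.r = 1 := by
    rcases hr.lt_or_eq with hrlt | hreq
    · exfalso
      have hr' : Valued.v C.r ≤ WithZero.exp (-1 : ℤ) := by
        have := withZero_le_exp_sub_one_of_lt_exp (k := 0) (by rwa [WithZero.exp_zero])
        simpa using this
      have hA : Valued.v (3 * C.r ^ 2) ≤ WithZero.exp (-1 : ℤ) := by
        rw [Valuation.map_mul, V3, one_mul, Valuation.map_pow, pow_two]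
        calc Valued.v C.r * Valued.v C.r ≤ 1 * WithZero.exp (-1 : ℤ) := mul_le_mul' hr hr'
          _ = WithZero.exp (-1 : ℤ) := one_mul _
      have hB : Valued.v (2 * C.s * C.t) ≤ WithZero.exp (-1 : ℤ) := by
        rw [Valuation.map_mul, Valuation.map_mul, V2]
        calc WithZero.exp (-2 : ℤ) * Valued.v C.s * Valued.v C.t
            ≤ 1 * 1 * WithZero.exp (-1 : ℤ) := mul_le_mul' (mul_le_mul' hlt20.le hs) ht
          _ = WithZero.exp (-1 : ℤ) := by rw [one_mul, one_mul]
      have hmle : Valued.v (m : w.adicCompletion K) ≤ WithZero.exp (-1 : ℤ) := by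
        rw [show (m : w.adicCompletion K) =
          ((m : w.adicCompletion K) + 3 * C.r ^ 2 - 2 * C.s * C.t) - 3 * C.r ^ 2 +
            2 * C.s * C.t by ring]
        refine Valuation.map_add_le _ (Valuation.map_sub_le _ (hE4.trans ?_) hA) hB
        rw [WithZero.exp_le_exp]; norm_num
      rw [Vm] at hmle
      exact absurd (lt_of_le_of_lt hmle hlt10) (lt_irrefl _)
    · exact hreq
  -- Step 4: `s` is a unit (`3r = (3r - s²) + s²` and `|3r| = 1`)
  have hs1 : Valued.v C.s = 1 := by
    rcases hs.lt_or_eq with hslt | hseq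
    · exfalso
      have hs' : Valued.v C.s ≤ WithZero.exp (-1 : ℤ) := by
        have := withZero_le_exp_sub_one_of_lt_exp (k := 0) (by rwa [WithZero.exp_zero])
        simpa using this
      have hs2 : Valued.v (C.s ^ 2) ≤ WithZero.exp (-1 : ℤ) := by
        rw [Valuation.map_pow, pow_two]
        calc Valued.v C.s * Valued.v C.s ≤ 1 * WithZero.exp (-1 : ℤ) := mul_le_mul' hs hs'
          _ = WithZero.exp (-1 : ℤ) := one_mul _
      have h3r : Valued.v (3 * C.r) ≤ WithZero.exp (-1 : ℤ) := by
        rw [show (3 : w.adicCompletion K) * C.r = (3 * C.r - C.s ^ 2) + C.s ^ 2 by ring]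
        refine Valuation.map_add_le _ (hrs.trans ?_) hs2
        rw [WithZero.exp_le_exp]; norm_num
      rw [Valuation.map_mul, V3, one_mul, hr1] at h3r
      exact absurd (lt_of_le_of_lt h3r hlt10) (lt_irrefl _)
    · exact hseq
  -- Step 5: `s ≡ 1 (mod π)`, `s² ≡ 1 (mod π²)`, `3r ≡ 1 (mod π²)`, `r ≡ 1 (mod π²)`
  have hs_1 : Valued.v (C.s - 1) ≤ WithZero.exp (-1 : ℤ) := hres _ hs1
  have hs21 : Valued.v (C.s ^ 2 - 1) ≤ WithZero.exp (-2 : ℤ) := by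
    have hsp : Valued.v (C.s + 1) ≤ WithZero.exp (-1 : ℤ) := by
      rw [show C.s + 1 = (C.s - 1) + 2 by ring]
      refine Valuation.map_add_le _ hs_1 ?_
      rw [V2, WithZero.exp_le_exp]; norm_num
    rw [show C.s ^ 2 - 1 = (C.s - 1) * (C.s + 1) by ring, Valuation.map_mul]
    calc Valued.v (C.s - 1) * Valued.v (C.s + 1)
        ≤ WithZero.exp (-1 : ℤ) * WithZero.exp (-1 : ℤ) := mul_le_mul' hs_1 hsp
      _ = WithZero.exp (-2 : ℤ) := by rw [withZero_exp_mul_exp]; norm_num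
  have hr_1 : Valued.v (C.r - 1) ≤ WithZero.exp (-2 : ℤ) := by
    have h3r1 : Valued.v (3 * C.r - 1) ≤ WithZero.exp (-2 : ℤ) := by
      rw [show (3 : w.adicCompletion K) * C.r - 1 = (3 * C.r - C.s ^ 2) + (C.s ^ 2 - 1) by ring]
      exact Valuation.map_add_le _ hrs hs21
    have h3 : Valued.v (3 * (C.r - 1)) ≤ WithZero.exp (-2 : ℤ) := by
      rw [show (3 : w.adicCompletion K) * (C.r - 1) = (3 * C.r - 1) - 2 by ring]
      exact Valuation.map_sub_le _ h3r1 V2.le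
    rwa [Valuation.map_mul, V3, one_mul] at h3
  -- Step 6: `r² ≡ 1 (mod π⁴)`
  have hr21 : Valued.v (C.r ^ 2 - 1) ≤ WithZero.exp (-4 : ℤ) := by
    have hrp : Valued.v (C.r + 1) ≤ WithZero.exp (-2 : ℤ) := by
      rw [show C.r + 1 = (C.r - 1) + 2 by ring]
      exact Valuation.map_add_le _ hr_1 V2.le
    rw [show C.r ^ 2 - 1 = (C.r - 1) * (C.r + 1) by ring, Valuation.map_mul]
    calc Valued.v (C.r - 1) * Valued.v (C.r + 1)
        ≤ WithZero.exp (-2 : ℤ) * WithZero.exp (-2 : ℤ) := mul_le_mul' hr_1 hrp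
      _ = WithZero.exp (-4 : ℤ) := by rw [withZero_exp_mul_exp]; norm_num
  have h3r21 : Valued.v (3 * (C.r ^ 2 - 1)) ≤ WithZero.exp (-4 : ℤ) := by
    rw [Valuation.map_mul, V3, one_mul]; exact hr21
  -- `|2st| = exp(-2) |t|`
  have h2st : Valued.v (2 * C.s * C.t) = WithZero.exp (-2 : ℤ) * Valued.v C.t := by
    rw [Valuation.map_mul, Valuation.map_mul, V2, hs1, mul_one]
  have h2st3 : Valued.v (2 * C.s * C.t) ≤ WithZero.exp (-3 : ℤ) := by
    rw [h2st]
    calc WithZero.exp (-2 : ℤ) * Valued.v C.t ≤ WithZero.exp (-2 : ℤ) * WithZero.exp (-1 : ℤ) :=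
          mul_le_mul' le_rfl ht
      _ = WithZero.exp (-3 : ℤ) := by rw [withZero_exp_mul_exp]; norm_num
  -- the key decomposition `m + 3r² - 2st = (m + 3) + (3(r² - 1) - 2st)`
  have hdec : (m : w.adicCompletion K) + 3 * C.r ^ 2 - 2 * C.s * C.t =
      ((m : w.adicCompletion K) + 3) + (3 * (C.r ^ 2 - 1) - 2 * C.s * C.t) := by ring
  -- Step 7: case distinction on `m mod 4`
  obtain ⟨n, rfl⟩ := hm
  rcases Int.emod_two_eq_zero_or_one n with hn | hn
  · -- `m = 2n + 1 ≡ 1 (mod 4)`: `4 ∣ m + 3`, `m + 1 = 2 · odd`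
    obtain ⟨k, rfl⟩ : ∃ k, n = 2 * k := ⟨n / 2, by omega⟩
    have hm3 : Valued.v (((2 * (2 * k) + 1 : ℤ) : w.adicCompletion K) + 3) ≤
        WithZero.exp (-4 : ℤ) := by
      have h := hZle (2 * (2 * k) + 1 + 3) 2 ⟨k + 1, by ring⟩
      have h4 : WithZero.exp (-((2 : ℕ) : ℤ)) ^ 2 = WithZero.exp (-4 : ℤ) := by
        rw [← WithZero.exp_nsmul]; norm_num
      rw [h4] at h
      exact_mod_cast h
    -- `|t| ≤ exp(-2)`
    have ht' : Valued.v C.t ≤ WithZero.exp (-2 : ℤ) := by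
      have h2st4 : Valued.v (2 * C.s * C.t) ≤ WithZero.exp (-4 : ℤ) := by
        rw [show 2 * C.s * C.t = (((2 * (2 * k) + 1 : ℤ) : w.adicCompletion K) + 3) +
          3 * (C.r ^ 2 - 1) -
          (((2 * (2 * k) + 1 : ℤ) : w.adicCompletion K) + 3 * C.r ^ 2 - 2 * C.s * C.t) by ring]
        exact Valuation.map_sub_le _ (Valuation.map_add_le _ hm3 h3r21) hE4
      rw [h2st] at h2st4
      refine withZero_le_of_exp_mul_le_exp_mul (k := -2) ?_
      rw [withZero_exp_mul_exp]
      norm_num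
      exact h2st4
    have ht2' : Valued.v (C.t ^ 2) ≤ WithZero.exp (-4 : ℤ) := by
      rw [Valuation.map_pow]
      calc Valued.v C.t ^ 2 ≤ WithZero.exp (-2 : ℤ) ^ 2 := pow_le_pow_left' ht' 2
        _ = WithZero.exp (-4 : ℤ) := by rw [← WithZero.exp_nsmul]; norm_num
    -- `|m + 1| = exp(-2)` and `|m + r²| = exp(-2)`
    have hm1 : Valued.v (((2 * (2 * k) + 1 : ℤ) : w.adicCompletion K) + 1) =
        WithZero.exp (-2 : ℤ) := by
      have h := hZpow (2 * k + 1) 1 (by omega)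
      rw [pow_one, pow_one] at h
      rw [← h]
      congr 1
      push_cast
      ring
    have hmr : Valued.v (((2 * (2 * k) + 1 : ℤ) : w.adicCompletion K) + C.r ^ 2) =
        WithZero.exp (-2 : ℤ) := by
      rw [show ((2 * (2 * k) + 1 : ℤ) : w.adicCompletion K) + C.r ^ 2 =
        (((2 * (2 * k) + 1 : ℤ) : w.adicCompletion K) + 1) + (C.r ^ 2 - 1) by ring,
        Valuation.map_add_eq_of_lt_left, hm1]
      rw [hm1]
      refine lt_of_le_of_lt hr21 ?_
      rw [WithZero.exp_lt_exp]; norm_num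
    -- Step 8: `|rm + r³ - t²| = exp(-2) > exp(-6)`
    have hmain : Valued.v (C.r * ((2 * (2 * k) + 1 : ℤ) : w.adicCompletion K) + C.r ^ 3 -
        C.t ^ 2) = WithZero.exp (-2 : ℤ) := by
      have hfirst : Valued.v (C.r * (((2 * (2 * k) + 1 : ℤ) : w.adicCompletion K) + C.r ^ 2)) =
          WithZero.exp (-2 : ℤ) := by
        rw [Valuation.map_mul, hr1, one_mul, hmr]
      rw [show C.r * ((2 * (2 * k) + 1 : ℤ) : w.adicCompletion K) + C.r ^ 3 - C.t ^ 2 =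
        C.r * (((2 * (2 * k) + 1 : ℤ) : w.adicCompletion K) + C.r ^ 2) + (-(C.t ^ 2)) by ring,
        Valuation.map_add_eq_of_lt_left, hfirst]
      rw [hfirst, Valuation.map_neg]
      refine lt_of_le_of_lt ht2' ?_
      rw [WithZero.exp_lt_exp]; norm_num
    rw [hmain, WithZero.exp_le_exp] at hE6
    norm_num at hE6
  · -- `m = 2n + 1 ≡ 3 (mod 4)`: `m + 3 = 2 · odd`
    obtain ⟨k, rfl⟩ : ∃ k, n = 2 * k + 1 := ⟨n / 2, by omega⟩
    have hm3 : Valued.v (((2 * (2 * k + 1) + 1 : ℤ) : w.adicCompletion K) + 3) =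
        WithZero.exp (-2 : ℤ) := by
      have h := hZpow (2 * k + 3) 1 (by omega)
      rw [pow_one, pow_one] at h
      rw [← h]
      congr 1
      push_cast
      ring
    have hrest : Valued.v (3 * (C.r ^ 2 - 1) - 2 * C.s * C.t) ≤ WithZero.exp (-3 : ℤ) := by
      refine Valuation.map_sub_le _ (h3r21.trans ?_) h2st3
      rw [WithZero.exp_le_exp]; norm_num
    have hmain : Valued.v (((2 * (2 * k + 1) + 1 : ℤ) : w.adicCompletion K) + 3 * C.r ^ 2 -
        2 * C.s * C.t) = WithZero.exp (-2 : ℤ) := by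
      rw [hdec, Valuation.map_add_eq_of_lt_left, hm3]
      rw [hm3]
      refine lt_of_le_of_lt hrest ?_
      rw [WithZero.exp_lt_exp]; norm_num
    rw [hmain, WithZero.exp_le_exp] at hE4
    norm_num at hE4

/-- **`hβ` proved: the local Euler factor of `(y² = x³ + mx)_K` at the ramified place over
`2` is `1`** for odd `m` and the CM field `K ≅ ℚ(i)` of `j = 1728`: the equation is minimal over
`𝓞_w` (`isMinimal_baseChange_mk_odd`) with `|Δ|_w = exp(-12) < 1`, `|c₄|_w = exp(-8) < 1`, so
the reduction is additive (Silverman *AEC* VII.5.1(c), `hasAdditiveReductionAt_of_isMinimalAt`)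
and the local factor is `1` (`localEulerFactor_eq_one_of_hasAdditiveReductionAt`). This is
Silverman, *Advanced Topics*, Ex. 2.32(a), ramified case, for `E = y² = x³ + mx` over its CM
field (with the proof of Thm. 10.5(a): bad, hence additive, reduction at the ramified prime).
[cite: SilvermanATAEC1994, Ch. II Exercise 2.32(a) (PDF p. 179) with the proof of Thm. 10.5(a) (PDF p. 172)] -/
theorem localEulerFactor_baseChange_mk_odd_eq_one {m : ℤ} (hm : Odd m) (hK : IsCMFieldOfJ K 1728)
    (he : w.asIdeal.ramificationIdx (𝓞 ℚ) = 2) :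
    ((((⟨0, 0, 0, (m : ℚ), 0⟩ : WeierstrassCurve ℚ).baseChange K).baseChange
      (w.adicCompletion K)).localEulerFactor (w.adicCompletionIntegers K)) = 1 := by
  set v := w.under (𝓞 ℚ) with hv_def
  have hpd := natGenerator_dvd_cmFieldDiscr_of_ramificationIdx_eq_two
    (show (1728 : ℚ) ∈ maximalCMJInvariants by simp [maximalCMJInvariants]) K hK w he
  norm_num [cmFieldDiscr] at hpd
  have hv : natGenerator v = 2 := by
    have h4 : (natGenerator v : ℤ) ∣ 2 ^ 2 := by norm_num; exact hpd
    exact Rat.natGenerator_eq_of_dvd v Nat.prime_two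
      (by exact_mod_cast (Rat.prime_natGenerator_int v).dvd_of_dvd_pow h4)
  set E : WeierstrassCurve ℚ := ⟨0, 0, 0, (m : ℚ), 0⟩ with hE
  have h2m : ¬ ((natGenerator v : ℕ) : ℤ) ∣ m := by
    rw [hv]
    intro h
    exact Int.not_even_iff_odd.mpr hm (even_iff_two_dvd.mpr (by exact_mod_cast h))
  have h2m3 : ¬ ((natGenerator v : ℕ) : ℤ) ∣ -(m ^ 3) := fun h ↦
    h2m ((Rat.prime_natGenerator_int v).dvd_of_dvd_pow (Int.dvd_neg.mp h))
  have h23m : ¬ ((natGenerator v : ℕ) : ℤ) ∣ -3 * m := by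
    intro h
    rcases (Rat.prime_natGenerator_int v).dvd_or_dvd h with h3 | h3
    · rw [hv] at h3; norm_num at h3
    · exact h2m h3
  have hEΔ : E.Δ = (natGenerator v : ℚ) ^ 6 * ((-(m ^ 3) : ℤ) : ℚ) := by
    rw [hv]
    simp only [hE, WeierstrassCurve.Δ, WeierstrassCurve.b₂, WeierstrassCurve.b₄,
      WeierstrassCurve.b₆, WeierstrassCurve.b₈]
    push_cast
    ring
  have hEc₄ : E.c₄ = (natGenerator v : ℚ) ^ 4 * ((-3 * m : ℤ) : ℚ) := by
    rw [hv]
    simp only [hE, WeierstrassCurve.c₄, WeierstrassCurve.b₂, WeierstrassCurve.b₄]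
    push_cast
    ring
  have hvΔ : v.valuation ℚ E.Δ = WithZero.exp (-(6 : ℕ) : ℤ) := by
    rw [hEΔ]; exact WeierstrassCurve.Rat.valuation_pow_mul_intCast v h2m3 6
  have hvc₄ : v.valuation ℚ E.c₄ = WithZero.exp (-(4 : ℕ) : ℤ) := by
    rw [hEc₄]; exact WeierstrassCurve.Rat.valuation_pow_mul_intCast v h23m 4
  have hEΔ0 : E.Δ ≠ 0 := by
    intro h0
    rw [h0, Valuation.map_zero] at hvΔ
    exact WithZero.exp_ne_zero hvΔ.symm
  have hval : ∀ x : ℚ, w.valuation K (algebraMap ℚ K x) = v.valuation ℚ x ^ 2 :=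
    valuation_algebraMap_of_ramificationIdx_eq_two K w he
  have hmin : (E.baseChange K).IsMinimalAt w := isMinimal_baseChange_mk_odd K w hK hm he
  have hadd : (E.baseChange K).HasAdditiveReductionAt w := by
    refine hasAdditiveReductionAt_of_isMinimalAt w _ hmin ?_ ?_ ?_
    · rw [baseChange, map_Δ, hval, hvΔ, ← WithZero.exp_nsmul, ← WithZero.exp_zero,
        WithZero.exp_lt_exp]
      norm_num
    · rw [baseChange, map_c₄, hval, hvc₄, ← WithZero.exp_nsmul, ← WithZero.exp_zero,
        WithZero.exp_lt_exp]
      norm_num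
    · rw [baseChange, map_Δ]
      exact (map_ne_zero _).mpr hEΔ0
  exact localEulerFactor_eq_one_of_hasAdditiveReductionAt w _ hadd

end KSideOdd

/-! ### Assembly: the ramified statement for all `j`, and Deuring from the inert leaf alone -/

/-- **The ramified statement `hR` of Deuring's theorem, proved for every
`j ∈ maximalCMJInvariants`**: for `W/ℚ` elliptic with such a `j`-invariant, its CM field `K` and
a place `w` of `K` of ramification index `2`, both local Euler factors `L_w(W_K)` and `L_p(W)`
are `1` (`Deuring_localEulerFactor_ramified_of_j_ne_1728` for `j ≠ 1728`; `h1728_of_odd` with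
`localEulerFactor_baseChange_mk_odd_eq_one` for `j = 1728`). Silverman, *Advanced Topics*,
Ex. 2.31(a) and 2.32(a) (ramified case), together with the proof of Thm. 10.5(a) (a CM curve
has bad, hence additive, reduction at the primes where its Grössencharacter ramifies, Thm. 9.2(b)).
[cite: SilvermanATAEC1994, Ch. II Exercises 2.31(a), 2.32(a) (PDF p. 179) with Thm. 10.5 (a) and its proof (PDF pp. 171–172)] -/
theorem Deuring_localEulerFactor_ramified (W : WeierstrassCurve ℚ) [W.IsElliptic]
    (hj : W.j ∈ maximalCMJInvariants) (K : Type) [Field K] [NumberField K]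
    (hK : IsCMFieldOfJ K W.j) (w : HeightOneSpectrum (𝓞 K))
    (he : w.asIdeal.ramificationIdx (𝓞 ℚ) = 2) :
    ((W.baseChange K).baseChange (w.adicCompletion K)).localEulerFactor
        (w.adicCompletionIntegers K) = 1 ∧
      (W.baseChange ((w.under (𝓞 ℚ)).adicCompletion ℚ)).localEulerFactor
        ((w.under (𝓞 ℚ)).adicCompletionIntegers ℚ) = 1 := by
  by_cases h : W.j = 1728
  · exact h1728_of_odd
      (fun m hm K _ _ hK w he ↦ localEulerFactor_baseChange_mk_odd_eq_one K w hm hK he)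
      W h K hK w he
  · exact Deuring_localEulerFactor_ramified_of_j_ne_1728 W hj h K hK w he

/-- **Deuring's theorem prime by prime from the inert leaf alone**: the per-prime identity
`Deuring_localEulerFactor_baseChange_cmField` (★ₚ) follows from the inert statement `hI`
(`Deuring_localEulerFactor_baseChange_cmField_of_inert_of_ramified` with
`Deuring_localEulerFactor_ramified`). [cite: SilvermanATAEC1994, Ch. II Exercises 2.30–2.32 (PDF p. 179)] -/
theorem Deuring_localEulerFactor_baseChange_cmField_of_inert
    (hI : ∀ (W : WeierstrassCurve ℚ) [W.IsElliptic], W.j ∈ maximalCMJInvariants →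
      ∀ (K : Type) [Field K] [NumberField K], IsCMFieldOfJ K W.j →
        ∀ w : HeightOneSpectrum (𝓞 K), w.asIdeal.inertiaDeg (𝓞 ℚ) = 2 →
          ((W.baseChange K).baseChange (w.adicCompletion K)).localEulerFactor
              (w.adicCompletionIntegers K) =
            (W.baseChange ((w.under (𝓞 ℚ)).adicCompletion ℚ)).localEulerFactor
              ((w.under (𝓞 ℚ)).adicCompletionIntegers ℚ) ^ 2) :
    Deuring_localEulerFactor_baseChange_cmField :=
  Deuring_localEulerFactor_baseChange_cmField_of_inert_of_ramified hI
    (fun W _ hj K _ _ hK w he ↦ Deuring_localEulerFactor_ramified W hj K hK w he)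

/-- **Deuring's `L(E_K/K, s) = L(E/ℚ, s)²` from the inert leaf alone**
(`Deuring_LFunction_baseChange_cmField_of_local` applied to the above): after this file the
open content of `Deuring_LFunction_baseChange_cmField` is exactly the inert statement `hI`
(Silverman, *Advanced Topics*, Ex. 2.30(c), 2.32(a) inert case: `L_w(W_K) = L_p(W)²` at a place
of inertia degree `2`). [cite: SilvermanATAEC1994, Ch. II Thm. 10.5 (a), (b) (PDF p. 171)] -/
theorem Deuring_LFunction_baseChange_cmField_of_inert
    (hI : ∀ (W : WeierstrassCurve ℚ) [W.IsElliptic], W.j ∈ maximalCMJInvariants →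
      ∀ (K : Type) [Field K] [NumberField K], IsCMFieldOfJ K W.j →
        ∀ w : HeightOneSpectrum (𝓞 K), w.asIdeal.inertiaDeg (𝓞 ℚ) = 2 →
          ((W.baseChange K).baseChange (w.adicCompletion K)).localEulerFactor
              (w.adicCompletionIntegers K) =
            (W.baseChange ((w.under (𝓞 ℚ)).adicCompletion ℚ)).localEulerFactor
              ((w.under (𝓞 ℚ)).adicCompletionIntegers ℚ) ^ 2) :
    Deuring_LFunction_baseChange_cmField :=
  Deuring_LFunction_baseChange_cmField_of_local
    (Deuring_localEulerFactor_baseChange_cmField_of_inert hI)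

end Literature.NumberTheory.EllipticCurves

end
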